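import Literature.NumberTheory.LFunctions.DirichletLAtZero
import Literature.Analysis.SpecialFunctions.InvSinSqPartialFractions
import Literature.NumberTheory.LFunctions.OddCharLogDerivFE
import Mathlib.Analysis.Normed.Group.Tannery
import HarnessLib

/-!
# The cotangent values: `ζ_odd(x, 1) = (π/2) cot(πx)`, `∑_{n≥1} sin(2πnx) "at s = 0" = cot(πx)/2`,
# and `L(1, χ) = (π/2N) ∑_{j mod N} χ(j) cot(πj/N)` for every odd `χ`

Topic `Literature/NumberTheory/LFunctions`. THEOREMS only (no definition, no named fact); the `s = 1`
mirror of `DirichletLAtZero.lean` (which supplies `sinZeta x 1`, `hurwitzZetaOdd x 0`). Mathlib continues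
`ζ_odd(x, s) = ½ Σ_{n ∈ ℤ} sgn(n + x)|n + x|^{-s}` and `Σ_{n ≥ 1} sin(2πnx) n^{-s}` to all `s`
(`HurwitzZeta.hurwitzZetaOdd`, `HurwitzZeta.sinZeta`) but evaluates neither at the edge `s = 1`, resp.
`s = 0`, of convergence. We prove, for `0 < x < 1`:
* `hasSum_one_div_add_sub_one_div_add_one_sub` — `Σ_{n ≥ 0} (1/(n + x) − 1/(n + 1 − x)) = π cot(πx)`
  (the tree's real partial fractions `Analysis.SpecialFunctions.hasSum_pi_mul_cot_sub_inv` = Mathlib's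
  `cot_series_rep'`, re-bracketed; the difference telescopes to `1/x`);
* `hurwitzZetaOdd_apply_one` — **`ζ_odd(x, 1) = (π/2) cot(πx)`**: for real `1 < s ≤ 2` the Dirichlet
  series `½ Σ_n ((n + x)^{-s} − (n + 1 − x)^{-s})` (`HurwitzZeta.hasSum_nat_hurwitzZetaOdd_of_mem_Icc`) is
  dominated by `K/(n + 1)²`, `K = 2 + x^{-2} + (1 − x)^{-2}`, UNIFORMLY for `s ∈ [1, 2]`
  (`abs_rpow_neg_add_sub_le`, from `n^{-s} − (n+1)^{-s} ≤ 2/(n(n+1))`, `natCast_rpow_neg_sub_succ_rpow_neg_le` —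
  monotonicity of `t ↦ t^{-s}` only), so Tannery's theorem (`tendsto_tsum_of_dominated_convergence`) along
  `s_k = 1 + 1/(k+1)` and the continuity of the entire `ζ_odd(x, ·)`
  (`HurwitzZeta.differentiable_hurwitzZetaOdd`) give the value; the EVEN part (pole at `s = 1`) never
  enters;
* `sinZeta_apply_zero` — **`sinZeta x 0 = cot(πx)/2`** (the Abel value of `Σ_{n ≥ 1} sin(2πnx)`), from the
  COMPLETED functional equation `HurwitzZeta.completedHurwitzZetaOdd_one_sub` (all `s`) at `s = 0` with
  `Complex.Gammaℝ_one` and the tree's `OddCharLogDeriv.Gammaℝ_two` (`Γ_ℝ(2) = 1/π`);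
* `LFunction_apply_one_of_odd` — for an odd `Φ : ℤ/N → ℂ` (ANY level, primitive or not),
  **`L(Φ, 1) = (π/2N) Σ_{j mod N} Φ(j) cot(π j̃/N)`**, `j̃ ∈ [0, N)` (`ZMod.LFunction_def_odd` at `s = 1`,
  `ZMod.toAddCircle_apply`), and `dirichletLFunction_apply_one_of_odd` — LOUBOUTIN's closed formula
  `L(1, χ) = (π/2q) Σ_{a=1}^{q−1} χ(a) cot(πa/q)` for every odd non-principal `χ` mod `q`, NOT necessarily
  primitive [Louboutin1993] (obtained there exactly this way: `ζ(s, a/q)` + the partial fractions of `cot`;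
  quoted as the display for `L(1,χ)` on p. 3 of arXiv:2409.00813, held); for primitive `χ` it is Lang's
  `L(1, χ) = πi S(χ) B_{1,χ̄}/m` [Lang1990, Ch. 3 §2, Thm. 2.2, Case 2] through the tree's
  `CotangentCharacterSum.sum_mul_pi_mul_cot_eq_gaussSum_mul_bernoulli`;
* `sum_char_mul_cot_ne_zero_of_odd` — hence **`Σ_{j mod N} χ(j) cot(π j̃/N) = (2N/π) L(1, χ) ≠ 0`** for
  every odd Dirichlet character (Dirichlet's theorem, `DirichletCharacter.LFunction_apply_one_ne_zero`):
  the analytic input of Chowla's / Okada's theorem on the cotangent values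
  (`Transcendental/OkadaCotangentProofs.lean`).

HONEST FRAMING (cells pub-zeta5 / zeta5-irr: systematic search; no irrationality claim unless
kernel-certified): two classical special values and a textbook `L(1, χ)` formula made kernel theorems;
nothing here concerns `ζ(5)`.

## References

* S. Louboutin, *Quelques formules exactes pour des moyennes de fonctions L de Dirichlet*, Canad. Math.
  Bull. 36 (1993), 190–196, doi:10.4153/CMB-1993-028-8 (the closed formula for `L(1, χ)`, `χ` odd).
  [Louboutin1993]
* S. Lang, *Cyclotomic Fields I and II*, GTM 121 (1990), Ch. 3 §2, Thm. 2.2 and Case 2 (`χ` odd primitive: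
  `L(1, χ) = πi S(χ) B_{1,χ̄}/m`). [Lang1990]
* L. V. Ahlfors, *Complex Analysis*, 3rd ed. (1979), Ch. 5 §2.1 (11) (partial fractions of `π cot πz`).
  [AhlforsCA1979]
-/

noncomputable section

open Real Finset Filter Topology HurwitzZeta

namespace Literature.NumberTheory.LFunctions

namespace LValueOne

/-! ### The re-bracketed partial fractions `Σ_{n ≥ 0} (1/(n+x) − 1/(n+1−x)) = π cot(πx)` -/

/-- A real number strictly between `0` and `1` is not an integer. [folklore] -/
private theorem ne_intCast_of_mem_Ioo {x : ℝ} (hx0 : 0 < x) (hx1 : x < 1) (n : ℤ) : x ≠ n := by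
  rintro rfl
  have h0' : (0 : ℤ) < n := by exact_mod_cast hx0
  have h1' : n < (1 : ℤ) := by exact_mod_cast hx1
  omega

/-- The telescoping series `Σ_{n ≥ 0} (1/(n + x) − 1/(n + 1 + x)) = 1/x` (`x > 0`). [folklore] -/
private theorem hasSum_one_div_add_sub_one_div_add_one_add {x : ℝ} (hx0 : 0 < x) :
    HasSum (fun n : ℕ => 1 / ((n : ℝ) + x) - 1 / ((n : ℝ) + 1 + x)) (1 / x) := by
  have hnn : ∀ n : ℕ, 0 ≤ 1 / ((n : ℝ) + x) - 1 / ((n : ℝ) + 1 + x) := by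
    intro n
    rw [sub_nonneg]
    exact one_div_le_one_div_of_le (by positivity) (by linarith)
  rw [hasSum_iff_tendsto_nat_of_nonneg hnn]
  have hpart : ∀ N : ℕ, ∑ n ∈ range N, (1 / ((n : ℝ) + x) - 1 / ((n : ℝ) + 1 + x)) =
      1 / x - 1 / ((N : ℝ) + x) := by
    intro N
    have h := Finset.sum_range_sub' (fun n : ℕ => 1 / ((n : ℝ) + x)) N
    simp only [Nat.cast_zero, zero_add, Nat.cast_add, Nat.cast_one] at h
    rw [← h]
  simp_rw [hpart]
  have h1 : Tendsto (fun N : ℕ => 1 / ((N : ℝ) + x)) atTop (𝓝 0) := by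
    have : Tendsto (fun N : ℕ => (N : ℝ) + x) atTop atTop :=
      tendsto_atTop_add_const_right _ _ tendsto_natCast_atTop_atTop
    exact tendsto_const_nhds.div_atTop this
  have h2 : Tendsto (fun _ : ℕ => 1 / x) atTop (𝓝 (1 / x)) := tendsto_const_nhds
  simpa using h2.sub h1

/-- **`Σ_{n ≥ 0} (1/(n + x) − 1/(n + 1 − x)) = π cot(πx)`** for `0 < x < 1`: the partial fractions
`π cot(πx) − 1/x = Σ_{n ≥ 0} (1/(x − (n+1)) + 1/(x + (n+1)))` of the tree re-bracketed (adding the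
telescoping `Σ (1/(n+x) − 1/(n+1+x)) = 1/x`). [cite: AhlforsCA1979, Ch. 5 §2.1 (11)] -/
theorem hasSum_one_div_add_sub_one_div_add_one_sub {x : ℝ} (hx0 : 0 < x) (hx1 : x < 1) :
    HasSum (fun n : ℕ => 1 / ((n : ℝ) + x) - 1 / ((n : ℝ) + 1 - x)) (π * Real.cot (π * x)) := by
  have h1 := Analysis.SpecialFunctions.hasSum_pi_mul_cot_sub_inv (ne_intCast_of_mem_Ioo hx0 hx1)
  have h2 := hasSum_one_div_add_sub_one_div_add_one_add hx0
  have h := h1.add h2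
  rw [sub_add_cancel] at h
  refine h.congr_fun fun n => ?_
  have e1 : 1 / (x - ((n : ℝ) + 1)) = -(1 / ((n : ℝ) + 1 - x)) := by
    rw [← neg_sub ((n : ℝ) + 1) x, one_div_neg_eq_neg_one_div]
  have e2 : 1 / (x + ((n : ℝ) + 1)) = 1 / ((n : ℝ) + 1 + x) := by ring_nf
  rw [e1, e2]
  ring

/-! ### A uniform summable majorant for `(n + x)^{-s} − (n + 1 − x)^{-s}`, `1 ≤ s ≤ 2` -/

/-- `n^{-s} − (n+1)^{-s} ≤ 2/(n(n+1))` for `1 ≤ s ≤ 2`, `n ≥ 1` (write `(n+1)^{-s} = n^{-s} t^s`,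
`t = n/(n+1)`, and use `n^{-s} ≤ 1/n`, `t^s ≥ t²`). [folklore] -/
private theorem natCast_rpow_neg_sub_succ_rpow_neg_le {s : ℝ} (hs1 : 1 ≤ s) (hs2 : s ≤ 2) {n : ℕ} (hn : 1 ≤ n) :
    (n : ℝ) ^ (-s) - ((n : ℝ) + 1) ^ (-s) ≤ 2 / ((n : ℝ) * ((n : ℝ) + 1)) := by
  have hn0 : (0 : ℝ) < n := by exact_mod_cast hn
  have hn1 : (1 : ℝ) ≤ n := by exact_mod_cast hn
  set t : ℝ := (n : ℝ) / ((n : ℝ) + 1) with ht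
  have ht0 : 0 < t := by positivity
  have ht1 : t ≤ 1 := by rw [ht, div_le_one (by positivity)]; linarith
  have hsplit : ((n : ℝ) + 1) ^ (-s) = (n : ℝ) ^ (-s) * t ^ s := by
    have e : (n : ℝ) + 1 = (n : ℝ) * (((n : ℝ) + 1) / n) := by field_simp
    rw [e, Real.mul_rpow hn0.le (by positivity), ht]
    congr 1
    rw [Real.rpow_neg (by positivity), ← Real.inv_rpow (by positivity), inv_div]
  have hA : (n : ℝ) ^ (-s) ≤ 1 / n := by
    rw [one_div, ← Real.rpow_neg_one]
    exact Real.rpow_le_rpow_of_exponent_le hn1 (by linarith)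
  have hB : t ^ 2 ≤ t ^ s := by
    have h := Real.rpow_le_rpow_of_exponent_ge ht0 ht1 hs2
    rwa [show (2 : ℝ) = ((2 : ℕ) : ℝ) by norm_num, Real.rpow_natCast] at h
  have hts1 : t ^ s ≤ 1 := Real.rpow_le_one ht0.le ht1 (by linarith)
  have hns0 : 0 ≤ (n : ℝ) ^ (-s) := Real.rpow_nonneg hn0.le _
  calc (n : ℝ) ^ (-s) - ((n : ℝ) + 1) ^ (-s) = (n : ℝ) ^ (-s) * (1 - t ^ s) := by
        rw [hsplit]; ring
    _ ≤ (1 / n) * (1 - t ^ 2) :=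
        mul_le_mul hA (sub_le_sub_left hB 1) (sub_nonneg.mpr hts1) (by positivity)
    _ = (2 * n + 1) / ((n : ℝ) * ((n : ℝ) + 1) ^ 2) := by
        rw [ht]
        field_simp
        ring
    _ ≤ 2 / ((n : ℝ) * ((n : ℝ) + 1)) := by
        rw [div_le_div_iff₀ (by positivity) (by positivity)]
        nlinarith

/-- The sandwich: for `u, v ∈ [n, n+1]`, `n ≥ 1`, `s ≥ 0`, `|u^{-s} − v^{-s}| ≤ n^{-s} − (n+1)^{-s}`.
[folklore] -/
private theorem abs_rpow_neg_sub_rpow_neg_le_of_mem_Icc {s : ℝ} (hs : 0 ≤ s) {n : ℕ} (hn : 1 ≤ n) {u v : ℝ}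
    (hu1 : (n : ℝ) ≤ u) (hu2 : u ≤ (n : ℝ) + 1) (hv1 : (n : ℝ) ≤ v) (hv2 : v ≤ (n : ℝ) + 1) :
    |u ^ (-s) - v ^ (-s)| ≤ (n : ℝ) ^ (-s) - ((n : ℝ) + 1) ^ (-s) := by
  have hn0 : (0 : ℝ) < n := by exact_mod_cast hn
  have hu0 : 0 < u := lt_of_lt_of_le hn0 hu1
  have hv0 : 0 < v := lt_of_lt_of_le hn0 hv1
  have hs' : -s ≤ 0 := by linarith
  have hu3 : u ^ (-s) ≤ (n : ℝ) ^ (-s) := Real.rpow_le_rpow_of_nonpos hn0 hu1 hs'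
  have hu4 : ((n : ℝ) + 1) ^ (-s) ≤ u ^ (-s) := Real.rpow_le_rpow_of_nonpos hu0 hu2 hs'
  have hv3 : v ^ (-s) ≤ (n : ℝ) ^ (-s) := Real.rpow_le_rpow_of_nonpos hn0 hv1 hs'
  have hv4 : ((n : ℝ) + 1) ^ (-s) ≤ v ^ (-s) := Real.rpow_le_rpow_of_nonpos hv0 hv2 hs'
  rw [abs_sub_le_iff]
  constructor <;> linarith

/-- **The uniform majorant.** For `0 < x < 1`, `1 ≤ s ≤ 2` and every `n`,
`|(n + x)^{-s} − (n + 1 − x)^{-s}| ≤ K/(n + 1)²` with `K = 2 + x^{-2} + (1 − x)^{-2}`. [folklore] -/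
private theorem abs_rpow_neg_add_sub_le {x : ℝ} (hx0 : 0 < x) (hx1 : x < 1) {s : ℝ} (hs1 : 1 ≤ s)
    (hs2 : s ≤ 2) (n : ℕ) :
    |((n : ℝ) + x) ^ (-s) - ((n : ℝ) + 1 - x) ^ (-s)| ≤
      (2 + x ^ (-(2 : ℝ)) + (1 - x) ^ (-(2 : ℝ))) * (1 / ((n : ℝ) + 1) ^ 2) := by
  have hx1' : 0 < 1 - x := by linarith
  have hK1 : 0 ≤ x ^ (-(2 : ℝ)) := Real.rpow_nonneg hx0.le _
  have hK2 : 0 ≤ (1 - x) ^ (-(2 : ℝ)) := Real.rpow_nonneg hx1'.le _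
  rcases Nat.eq_zero_or_pos n with rfl | hn
  · -- `n = 0`: `|x^{-s} − (1−x)^{-s}| ≤ x^{-2} + (1−x)^{-2}`
    simp only [Nat.cast_zero, zero_add]
    have h1 : x ^ (-s) ≤ x ^ (-(2 : ℝ)) :=
      Real.rpow_le_rpow_of_exponent_ge hx0 hx1.le (by linarith)
    have h2 : (1 - x) ^ (-s) ≤ (1 - x) ^ (-(2 : ℝ)) :=
      Real.rpow_le_rpow_of_exponent_ge hx1' (by linarith) (by linarith)
    have h3 : 0 ≤ x ^ (-s) := Real.rpow_nonneg hx0.le _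
    have h4 : 0 ≤ (1 - x) ^ (-s) := Real.rpow_nonneg hx1'.le _
    rw [abs_sub_le_iff]
    constructor <;> nlinarith
  · have hn0 : (0 : ℝ) < n := by exact_mod_cast hn
    have hsand := abs_rpow_neg_sub_rpow_neg_le_of_mem_Icc (by linarith : (0 : ℝ) ≤ s) hn
      (u := (n : ℝ) + x) (v := (n : ℝ) + 1 - x) (by linarith) (by linarith) (by linarith) (by linarith)
    have hmain := natCast_rpow_neg_sub_succ_rpow_neg_le hs1 hs2 hn
    have hn1 : (1 : ℝ) ≤ n := by exact_mod_cast hn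
    have hcmp : 2 / ((n : ℝ) * ((n : ℝ) + 1)) ≤ 4 * (1 / ((n : ℝ) + 1) ^ 2) := by
      rw [mul_one_div, div_le_div_iff₀ (by positivity) (by positivity)]
      nlinarith
    have hpos : 0 ≤ 1 / ((n : ℝ) + 1) ^ 2 := by positivity
    have hK1' : 1 ≤ x ^ (-(2 : ℝ)) :=
      Real.one_le_rpow_of_pos_of_le_one_of_nonpos hx0 hx1.le (by norm_num)
    have hK2' : 1 ≤ (1 - x) ^ (-(2 : ℝ)) :=
      Real.one_le_rpow_of_pos_of_le_one_of_nonpos hx1' (by linarith) (by norm_num)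
    calc |((n : ℝ) + x) ^ (-s) - ((n : ℝ) + 1 - x) ^ (-s)| ≤ 4 * (1 / ((n : ℝ) + 1) ^ 2) :=
          hsand.trans (hmain.trans hcmp)
      _ ≤ (2 + x ^ (-(2 : ℝ)) + (1 - x) ^ (-(2 : ℝ))) * (1 / ((n : ℝ) + 1) ^ 2) :=
          mul_le_mul_of_nonneg_right (by linarith) hpos

/-! ### `ζ_odd(x, 1) = (π/2) cot(πx)` -/

/-- Cast of a real term `u^{-s}` to `ℂ`: `1/u^s` with complex power (`u > 0`). [folklore] -/
private theorem ofReal_rpow_neg_eq_one_div_cpow {u : ℝ} (hu : 0 < u) (s : ℝ) :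
    ((u ^ (-s) : ℝ) : ℂ) = 1 / (u : ℂ) ^ (s : ℂ) := by
  rw [Real.rpow_neg hu.le, Complex.ofReal_inv, Complex.ofReal_cpow hu.le, one_div]

/-- **The odd Hurwitz zeta function at `s = 1`**: for `0 < x < 1`,
`ζ_odd(x, 1) = ½ (ζ(s, x) − ζ(s, 1 − x))|_{s = 1} = ½ Σ_{n ≥ 0} (1/(n + x) − 1/(n + 1 − x)) = (π/2) cot(πx)`
(Tannery's theorem along `s ↓ 1` for the Dirichlet series of the entire function `ζ_odd(x, ·)`, then the
partial fractions of the cotangent [AhlforsCA1979, Ch. 5 §2.1 (11)]); the value Mathlib's `hurwitzZetaOdd_one_sub`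
cannot reach (`Γ(s) sin(πs/2)` at `s = 0`), and the analytic half of Louboutin's closed formula for `L(1, χ)`.
[cite: Louboutin1993, the formula `L(1,χ) = (π/2q) Σ χ(a) cot(πa/q)` (via `ζ(s, a/q)` and the partial fractions of `cot`), as quoted in arXiv:2409.00813, p. 3, eq. for `L(1,χ)`]
[cite: AhlforsCA1979, Ch. 5 §2.1 (11)] -/
theorem hurwitzZetaOdd_apply_one {x : ℝ} (hx0 : 0 < x) (hx1 : x < 1) :
    hurwitzZetaOdd (x : UnitAddCircle) 1 = ((π / 2 * Real.cot (π * x) : ℝ) : ℂ) := by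
  -- the sequence `s_k = 1 + 1/(k+1) ∈ (1, 2]`
  set sq : ℕ → ℝ := fun k => 1 + 1 / ((k : ℝ) + 1) with hsq
  have hsq1 : ∀ k, 1 < sq k := fun k => by
    simp only [hsq]
    have : (0 : ℝ) < 1 / ((k : ℝ) + 1) := by positivity
    linarith
  have hsq2 : ∀ k, sq k ≤ 2 := fun k => by
    simp only [hsq]
    have : 1 / ((k : ℝ) + 1) ≤ 1 := by
      rw [div_le_one (by positivity)]
      linarith [(k.cast_nonneg : (0 : ℝ) ≤ k)]
    linarith
  have hsqlim : Tendsto sq atTop (𝓝 1) := by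
    have h0 : Tendsto sq atTop (𝓝 (1 + 0)) := (tendsto_one_div_add_atTop_nhds_zero_nat).const_add 1
    rwa [add_zero] at h0
  -- the terms, as real numbers cast to `ℂ`
  set f : ℕ → ℕ → ℂ := fun k n =>
    (((((n : ℝ) + x) ^ (-sq k) - ((n : ℝ) + 1 - x) ^ (-sq k)) / 2 : ℝ) : ℂ) with hf
  set g : ℕ → ℂ := fun n => (((1 / ((n : ℝ) + x) - 1 / ((n : ℝ) + 1 - x)) / 2 : ℝ) : ℂ) with hg
  have hx1' : 0 < 1 - x := by linarith
  -- (1) the Dirichlet series at `s_k` sums to `ζ_odd(x, s_k)`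
  have hser : ∀ k, HasSum (f k) (hurwitzZetaOdd (x : UnitAddCircle) (sq k : ℂ)) := by
    intro k
    have h := hasSum_nat_hurwitzZetaOdd_of_mem_Icc (a := x) ⟨hx0.le, hx1.le⟩ (s := ((sq k : ℝ) : ℂ))
      (by simpa using hsq1 k)
    refine h.congr_fun fun n => ?_
    have hu : (0 : ℝ) < (n : ℝ) + x := by positivity
    have hv : (0 : ℝ) < (n : ℝ) + 1 - x := by linarith [(n.cast_nonneg : (0 : ℝ) ≤ n)]
    simp only [hf]
    rw [Complex.ofReal_div, Complex.ofReal_sub, ofReal_rpow_neg_eq_one_div_cpow hu,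
      ofReal_rpow_neg_eq_one_div_cpow hv]
    push_cast
    ring_nf
  -- (2) termwise convergence `f k n → g n` (continuity of `s ↦ u^{-s}` at `s = 1`)
  have hpow : ∀ {u : ℝ}, 0 < u → Tendsto (fun k => u ^ (-sq k)) atTop (𝓝 (1 / u)) := by
    intro u hu
    have hc : Continuous (fun s : ℝ => u ^ (-s)) := (Real.continuous_const_rpow hu.ne').comp continuous_neg
    have h := (hc.tendsto 1).comp hsqlim
    rwa [Function.comp_def, Real.rpow_neg_one, ← one_div] at h
  have hterm : ∀ n, Tendsto (fun k => f k n) atTop (𝓝 (g n)) := by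
    intro n
    simp only [hf, hg]
    have hu : (0 : ℝ) < (n : ℝ) + x := by positivity
    have hv : (0 : ℝ) < (n : ℝ) + 1 - x := by linarith [(n.cast_nonneg : (0 : ℝ) ≤ n)]
    exact (Complex.continuous_ofReal.tendsto _).comp (((hpow hu).sub (hpow hv)).div_const 2)
  -- (3) the uniform majorant
  set K : ℝ := 2 + x ^ (-(2 : ℝ)) + (1 - x) ^ (-(2 : ℝ)) with hK
  have hbound : ∀ᶠ k in atTop, ∀ n, ‖f k n‖ ≤ K / 2 * (1 / ((n : ℝ) + 1) ^ 2) := by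
    refine Filter.Eventually.of_forall fun k n => ?_
    simp only [hf, Complex.norm_real, Real.norm_eq_abs, abs_div, abs_two]
    have h := abs_rpow_neg_add_sub_le hx0 hx1 (hsq1 k).le (hsq2 k) n
    rw [← hK] at h
    have hpos : 0 ≤ 1 / ((n : ℝ) + 1) ^ 2 := by positivity
    linarith
  have hsumm : Summable fun n : ℕ => K / 2 * (1 / ((n : ℝ) + 1) ^ 2) := by
    refine Summable.mul_left _ ?_
    have h := (summable_nat_add_iff 1).mpr (Real.summable_one_div_nat_pow.mpr one_lt_two)
    refine h.congr fun n => ?_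
    push_cast
    ring_nf
  -- (4) Tannery
  have hT := tendsto_tsum_of_dominated_convergence hsumm hterm hbound
  have hT' : Tendsto (fun k => hurwitzZetaOdd (x : UnitAddCircle) (sq k : ℂ)) atTop (𝓝 (∑' n, g n)) := by
    refine hT.congr fun k => ?_
    exact (hser k).tsum_eq
  -- (5) continuity of `ζ_odd(x, ·)` at `1`
  have hcont : Tendsto (fun k => hurwitzZetaOdd (x : UnitAddCircle) (sq k : ℂ)) atTop
      (𝓝 (hurwitzZetaOdd (x : UnitAddCircle) 1)) := by
    have hc : Continuous (hurwitzZetaOdd (x : UnitAddCircle)) :=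
      (differentiable_hurwitzZetaOdd _).continuous
    have hs : Tendsto (fun k => ((sq k : ℝ) : ℂ)) atTop (𝓝 (1 : ℂ)) :=
      (Complex.continuous_ofReal.tendsto 1).comp hsqlim
    exact (hc.tendsto 1).comp hs
  -- (6) the value of `Σ g`
  have hgsum : HasSum g ((π / 2 * Real.cot (π * x) : ℝ) : ℂ) := by
    have h := (hasSum_one_div_add_sub_one_div_add_one_sub hx0 hx1).div_const 2
    have h' := Complex.hasSum_ofReal.mpr h
    simp only [hg]
    rw [show (π / 2 * Real.cot (π * x) : ℝ) = π * Real.cot (π * x) / 2 by ring]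
    exact h'
  rw [tendsto_nhds_unique hcont hT', hgsum.tsum_eq]

/-! ### `sinZeta x 0 = cot(πx)/2` -/

/-- **The sine zeta function at `s = 0`**: for `0 < x < 1`, `sinZeta x 0 = cot(πx)/2` — the value
"`Σ_{n ≥ 1} sin(2πnx)`" of the analytically continued sine series (its Abel sum), from the completed
functional equation `Λ_odd(x, 1 − s) = Λ_sin(x, s)` at `s = 0` and `ζ_odd(x, 1) = (π/2) cot(πx)`, i.e. the
partial-fraction value `½ Σ_{n ∈ ℤ} 1/(n + x) = (π/2) cot(πx)` [AhlforsCA1979, Ch. 5 §2.1 (11)] divided by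
`Γ_ℝ(1)/Γ_ℝ(2) = π` (our rendering at `s = 0` of Mathlib's `sinZeta`; no new analytic input).
[cite: AhlforsCA1979, Ch. 5 §2.1 (11)] -/
theorem sinZeta_apply_zero {x : ℝ} (hx0 : 0 < x) (hx1 : x < 1) :
    sinZeta (x : UnitAddCircle) 0 = ((Real.cot (π * x) / 2 : ℝ) : ℂ) := by
  have h1 : sinZeta (x : UnitAddCircle) 0 = completedSinZeta (x : UnitAddCircle) 0 := by
    rw [sinZeta, zero_add, Complex.Gammaℝ_one, div_one]
  have h2 : completedSinZeta (x : UnitAddCircle) 0 = completedHurwitzZetaOdd (x : UnitAddCircle) 1 := by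
    rw [← completedHurwitzZetaOdd_one_sub, sub_zero]
  have h3 : completedHurwitzZetaOdd (x : UnitAddCircle) 1 =
      hurwitzZetaOdd (x : UnitAddCircle) 1 * Complex.Gammaℝ 2 := by
    rw [hurwitzZetaOdd, show (1 : ℂ) + 1 = 2 by norm_num, div_mul_cancel₀]
    rw [OddCharLogDeriv.Gammaℝ_two]
    exact inv_ne_zero (Complex.ofReal_ne_zero.mpr Real.pi_ne_zero)
  rw [h1, h2, h3, hurwitzZetaOdd_apply_one hx0 hx1, OddCharLogDeriv.Gammaℝ_two]
  have hπ : (π : ℂ) ≠ 0 := Complex.ofReal_ne_zero.mpr Real.pi_ne_zero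
  push_cast
  field_simp

end LValueOne

/-! ### `L(1, χ) = (π/2N) Σ χ(j) cot(π j/N)` for odd `χ` -/

open LValueOne in
/-- **`L(1, Φ)` for an odd function** `Φ : ℤ/Nℤ → ℂ` (any level `N ≥ 1`; no primitivity):
`L(Φ, 1) = N^{-1} Σ_j Φ(j) ζ_odd(j/N, 1) = (π/2N) Σ_{j mod N} Φ(j) cot(π j̃/N)`, `j̃ ∈ [0, N)` the
representative (the term `j = 0` vanishes: `Φ(0) = 0`) — Louboutin's closed formula, stated for odd functions.
[cite: Louboutin1993, `L(1,χ) = (π/2q) Σ_{a=1}^{q−1} χ(a) cot(πa/q)` for odd non-principal `χ` mod `q`, not necessarily primitive (as quoted in arXiv:2409.00813, p. 3)] -/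
theorem LFunction_apply_one_of_odd {N : ℕ} [NeZero N] {Φ : ZMod N → ℂ} (hΦ : Φ.Odd) :
    ZMod.LFunction Φ 1 =
      π / (2 * N) * ∑ j : ZMod N, Φ j * Complex.cot (π * ((j.val : ℂ) / N)) := by
  have hN0 : (0 : ℝ) < N := Nat.cast_pos.mpr (NeZero.pos N)
  have hN0' : (N : ℂ) ≠ 0 := by exact_mod_cast (NeZero.ne N)
  have hΦ0 : Φ 0 = 0 := by
    have h := hΦ 0
    rw [neg_zero] at h
    have h3 : Φ 0 + Φ 0 = 0 := by linear_combination h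
    exact add_self_eq_zero.mp h3
  have hval : ∀ j : ZMod N, Φ j * hurwitzZetaOdd (ZMod.toAddCircle j) 1 =
      Φ j * ((π : ℂ) / 2 * Complex.cot (π * ((j.val : ℂ) / N))) := by
    intro j
    by_cases hj : j.val = 0
    · have : j = 0 := by rwa [ZMod.val_eq_zero] at hj
      subst this
      simp [hΦ0]
    · rw [ZMod.toAddCircle_apply]
      have hjpos : 0 < j.val := Nat.pos_of_ne_zero hj
      have hy0 : (0 : ℝ) < j.val / N := by positivity
      have hy1 : (j.val : ℝ) / N < 1 := by
        rw [div_lt_one hN0]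
        exact_mod_cast ZMod.val_lt j
      rw [hurwitzZetaOdd_apply_one hy0 hy1]
      push_cast
      ring_nf
  have hsum : ∑ j : ZMod N, Φ j * ((π : ℂ) / 2 * Complex.cot (π * ((j.val : ℂ) / N))) =
      (π : ℂ) / 2 * ∑ j : ZMod N, Φ j * Complex.cot (π * ((j.val : ℂ) / N)) := by
    rw [Finset.mul_sum]
    exact Finset.sum_congr rfl fun j _ => by ring
  rw [ZMod.LFunction_def_odd hΦ, Complex.cpow_neg_one, Finset.sum_congr rfl (fun j _ => hval j),
    hsum, ← mul_assoc]
  congr 1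
  field_simp

/-- **`L(1, χ) = (π/2N) Σ_{a mod N} χ(a) cot(π ã/N)`** for an odd Dirichlet character `χ` modulo `N`
(any level `N`, `χ` not necessarily primitive; `ã ∈ [0, N)`); for primitive `χ` this is Lang's
`L(1, χ) = πi S(χ) B_{1,χ̄}/m` [Lang1990, Ch. 3 §2, Thm. 2.2, Case 2] combined with the tree's
`LFunctions.sum_mul_pi_mul_cot_eq_gaussSum_mul_bernoulli`.
[cite: Louboutin1993, `L(1,χ) = (π/2q) Σ_{a=1}^{q−1} χ(a) cot(πa/q)` for odd non-principal `χ` (as quoted in arXiv:2409.00813, p. 3)] -/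
theorem dirichletLFunction_apply_one_of_odd {N : ℕ} [NeZero N] {χ : DirichletCharacter ℂ N}
    (hχ : χ.Odd) :
    χ.LFunction 1 = π / (2 * N) * ∑ a : ZMod N, χ a * Complex.cot (π * ((a.val : ℂ) / N)) :=
  LFunction_apply_one_of_odd hχ.to_fun

/-- An odd Dirichlet character is non-trivial. [folklore] -/
private theorem ne_one_of_odd {N : ℕ} [NeZero N] {χ : DirichletCharacter ℂ N} (hχ : χ.Odd) : χ ≠ 1 := by
  rintro rfl
  have h1 : (1 : DirichletCharacter ℂ N) (-1) = 1 := by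
    rw [show (-1 : ZMod N) = ((-1 : (ZMod N)ˣ) : ZMod N) by simp]
    exact MulChar.one_apply_coe _
  have h2 : (1 : DirichletCharacter ℂ N) (-1) = -1 := hχ
  rw [h1] at h2
  norm_num at h2

/-- **The cotangent character sum does not vanish**: for every odd Dirichlet character `χ` modulo `N`,
`Σ_{a mod N} χ(a) cot(π ã/N) = (2N/π) L(1, χ) ≠ 0` (Dirichlet's `L(1, χ) ≠ 0`, Mathlib
`DirichletCharacter.LFunction_apply_one_ne_zero`). This is the analytic input of Chowla's and Okada's
theorems on the `ℚ`-linear independence of the values `cot(πa/N)`. [cite: Okada1981, Theorem (proof)] -/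
theorem sum_char_mul_cot_ne_zero_of_odd {N : ℕ} [NeZero N] {χ : DirichletCharacter ℂ N}
    (hχ : χ.Odd) : ∑ a : ZMod N, χ a * Complex.cot (π * ((a.val : ℂ) / N)) ≠ 0 := by
  intro h0
  have hL := DirichletCharacter.LFunction_apply_one_ne_zero (ne_one_of_odd hχ)
  rw [dirichletLFunction_apply_one_of_odd hχ, h0, mul_zero] at hL
  exact hL rfl

end Literature.NumberTheory.LFunctions
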